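import Literature.NumberTheory.Automorphic.ArchGardingDensityRiesz
import Literature.NumberTheory.Automorphic.ArchGardingDerivationCalculus
import Literature.NumberTheory.Automorphic.HilbertRepSchurGraph
import HarnessLib

/-!
# Segal's infinitesimal Schur lemma on the Gårding space: invariant operators with a formal adjoint are scalars

Topic `NumberTheory/Automorphic`; namespace `Literature.NumberTheory.Automorphic`. Theorems only (no
definition, no named fact). For an irreducible unitary strongly continuous representation `τ` of
`G_∞ = GL_n(K_∞)` on a Hilbert space `E`, with Gårding space `𝒢 = archGardingSpace hcpt τ`:

* `exists_eq_smul_of_invariant_of_partner` — **Segal's lemma** (irreducible unitary representations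
  are quasi-simple; Segal (1952); Knapp–Vogan (1995), Introduction, Thm. 0.2; Wallach (1988), 1.2.2):
  a linear operator `C : 𝒢 → 𝒢` which commutes with every `τ(g)` and admits a *formal adjoint*
  `C'` on `𝒢` (`⟪C v, u⟫ = ⟪v, C' u⟫` for Gårding `v, u`) is a scalar, `C v = c • v`. Proof: the
  graph `Γ = {(v, C v)}` is a `G`-invariant linear relation in `E × E`; the formal adjoint and the
  density of `𝒢` (`dense_archGardingSpace`) make its closure a graph; the graph form of Schur's lemma
  (`HilbertRepSchurGraph`) concludes.
* `exists_archDerivE_scalar_eq_smul` — **central directions act by scalars**: for `x ∈ K_∞`,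
  `τ(x · 1_n) v = d_x • v` on Gårding vectors (`τ(g) τ(X) τ(g)⁻¹ = τ(gXg⁻¹) = τ(X)` for the central
  matrix `X = x · 1`, and `-τ(X)` is a formal adjoint by skew-symmetry).

The place Casimir operators are treated with the same lemma in `ArchPlaceCasimirScalar`. These are
the inputs "`Z` operates by scalars … `𝔷(G_r)`" of Jacquet–Shalika's automatic-continuity argument
(Jacquet–Shalika (1981), proof of Prop. (3.8), p. 523) on the route to the named fact
`Literature.NumberTheory.Automorphic.JacquetShalika1981_archKirillovNorm_le`.

## References

* I. E. Segal, *Hypermaximality of certain operators on Lie groups*, Proc. AMS 3 (1952), 13–15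
  [Segal1952].
* A. W. Knapp, D. A. Vogan, *Cohomological Induction and Unitary Representations*, Princeton
  (1995), Introduction, Thm. 0.2 and Notes [KnappVogan1995].
* N. R. Wallach, *Real Reductive Groups I*, Academic Press (1988), 1.2.2, 1.6.5 [WallachRRG1].
* H. Jacquet, J. A. Shalika, *On Euler products and the classification of automorphic
  representations I*, Amer. J. Math. 103 (1981), §3, Prop. (3.8), p. 523 [JacquetShalikaAJM1981].
-/

noncomputable section

open MeasureTheory Measure NumberField NumberField.mixedEmbedding IsDedekindDomain Set Filter
open scoped MatrixGroups ENNReal NNReal Classical Topology InnerProductSpace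

namespace Literature.NumberTheory.Automorphic

variable {n : ℕ} {K : Type} [Field K] [NumberField K]

attribute [local instance] glInfBorel borelSpace_glInf locallyCompactSpace_glInf secondCountableTopology_glInf

-- as in `ArchGardingWhittaker`
set_option backward.isDefEq.respectTransparency false

section Segal

variable {hcpt : isCompact_glFiniteIntegralLevel n K}
  {E : Type*} [NormedAddCommGroup E] [InnerProductSpace ℂ E] [CompleteSpace E]
  {τ : ContRepresentation ℂ (AutomorphyDatum.gl n K hcpt).arch.carrier E}

/-- **Segal's lemma (infinitesimal Schur).** Let `τ` be an irreducible unitary strongly continuous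
representation of `GL_n(K_∞)` on a Hilbert space and `C` an operator on its Gårding space `𝒢`,
additive and homogeneous there, commuting with every `τ(g)` on `𝒢`, and admitting a formal adjoint
`C'` on `𝒢`: `⟪C v, u⟫ = ⟪v, C' u⟫` for all Gårding `v, u`. Then `C` is a scalar on `𝒢`:
`C v = c • v`. (The closure of the `G`-invariant graph `{(v, C v)}` is a graph because
`(v_k, C v_k) → (0, y)` gives `⟪y, u⟫ = lim ⟪v_k, C' u⟫ = 0` for all Gårding `u`, a dense set; then
the graph form of Schur's lemma applies.) Segal (1952); Knapp–Vogan (1995), Introduction, Thm. 0.2.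
[cite: KnappVogan1995, Introduction, Thm. 0.2 and Notes] [cite: WallachRRG1, 1.2.2] -/
theorem exists_eq_smul_of_invariant_of_partner (hτ : τ.IsStronglyContinuous) (hτu : τ.IsUnitary)
    (hτi : τ.IsTopIrreducible) (C C' : E → E)
    (hadd : ∀ v ∈ archGardingSpace hcpt τ, ∀ v' ∈ archGardingSpace hcpt τ, C (v + v') = C v + C v')
    (hsmul : ∀ (c : ℂ), ∀ v ∈ archGardingSpace hcpt τ, C (c • v) = c • C v)
    (hinv : ∀ (g : GL (Fin n) (mixedSpace K)), ∀ v ∈ archGardingSpace hcpt τ,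
      τ (toArch hcpt g) (C v) = C (τ (toArch hcpt g) v))
    (hpartner : ∀ v ∈ archGardingSpace hcpt τ, ∀ u ∈ archGardingSpace hcpt τ, ⟪C v, u⟫_ℂ = ⟪v, C' u⟫_ℂ) :
    ∃ c : ℂ, ∀ v ∈ archGardingSpace hcpt τ, C v = c • v := by
  -- the graph of `C` as a linear relation
  set Γ : Submodule ℂ (E × E) :=
    { carrier := {x | x.1 ∈ archGardingSpace hcpt τ ∧ x.2 = C x.1}
      zero_mem' := by
        refine ⟨Submodule.zero_mem _, ?_⟩
        change (0 : E) = C 0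
        have h := hsmul 0 0 (Submodule.zero_mem _)
        rw [zero_smul, zero_smul] at h
        exact h.symm
      add_mem' := by
        rintro x y ⟨hx1, hx2⟩ ⟨hy1, hy2⟩
        refine ⟨Submodule.add_mem _ hx1 hy1, ?_⟩
        change x.2 + y.2 = C (x.1 + y.1)
        rw [hadd _ hx1 _ hy1, hx2, hy2]
      smul_mem' := by
        rintro c x ⟨hx1, hx2⟩
        refine ⟨Submodule.smul_mem _ c hx1, ?_⟩
        change c • x.2 = C (c • x.1)
        rw [hsmul c _ hx1, hx2] } with hΓ
  have hmemΓ : ∀ x : E × E, x ∈ Γ ↔ x.1 ∈ archGardingSpace hcpt τ ∧ x.2 = C x.1 := fun x => Iff.rfl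
  -- invariance under `τ g ⊕ τ g` (as a representation of the abstract group `G_∞`)
  have hinvΓ : ∀ g : (AutomorphyDatum.gl n K hcpt).arch.carrier, ∀ x ∈ Γ, (τ g x.1, τ g x.2) ∈ Γ := by
    rintro g x ⟨hx1, hx2⟩
    have hg : g = toArch hcpt (g : GL (Fin n) (mixedSpace K)) := rfl
    refine ⟨apply_mem_archGardingSpace hτ g hx1, ?_⟩
    change τ g x.2 = C (τ g x.1)
    rw [hx2, hg, hinv _ _ hx1]
  -- the closure of `Γ` is a graph
  have hgraph : ∀ y : E, ((0 : E), y) ∈ Γ.topologicalClosure → y = 0 := by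
    intro y hy
    rw [← SetLike.mem_coe, Submodule.topologicalClosure_coe, mem_closure_iff_seq_limit] at hy
    obtain ⟨x, hxΓ, hxlim⟩ := hy
    have h1 : Tendsto (fun k => (x k).1) atTop (𝓝 0) := (continuous_fst.tendsto _).comp hxlim
    have h2 : Tendsto (fun k => (x k).2) atTop (𝓝 y) := (continuous_snd.tendsto _).comp hxlim
    refine eq_zero_of_forall_inner_archGardingSpace (hcpt := hcpt) (τ := τ) hτ fun u hu => ?_
    -- `⟪y, u⟫ = lim ⟪(x k).2, u⟫ = lim ⟪C (x k).1, u⟫ = lim ⟪(x k).1, C' u⟫ = 0`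
    have hlim1 : Tendsto (fun k => ⟪(x k).2, u⟫_ℂ) atTop (𝓝 ⟪y, u⟫_ℂ) := h2.inner tendsto_const_nhds
    have hlim2 : Tendsto (fun k => ⟪(x k).1, C' u⟫_ℂ) atTop (𝓝 ⟪(0 : E), C' u⟫_ℂ) := h1.inner tendsto_const_nhds
    have heq : (fun k => ⟪(x k).2, u⟫_ℂ) = fun k => ⟪(x k).1, C' u⟫_ℂ := by
      funext k
      obtain ⟨hk1, hk2⟩ := (hmemΓ (x k)).1 (hxΓ k)
      rw [hk2, hpartner _ hk1 _ hu]
    rw [heq] at hlim1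
    have := tendsto_nhds_unique hlim1 hlim2
    rwa [inner_zero_left] at this
  obtain ⟨c, hc⟩ := hτi.exists_snd_eq_smul_fst_of_invariant hτu Γ hinvΓ hgraph
  exact ⟨c, fun v hv => hc (v, C v) ⟨hv, rfl⟩⟩

/-- **Central directions act by scalars on the Gårding space** of an irreducible unitary
representation: for `x ∈ K_∞` there is `d ∈ ℂ` with `τ(x · 1_n) v = d • v` for every Gårding `v`
(Segal's lemma for `C = τ(X)`, `X = x · 1` central: `τ(g) τ(X) v = τ(gXg⁻¹) τ(g) v = τ(X) τ(g) v`,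
formal adjoint `-τ(X)` by skew-symmetry). Jacquet–Shalika (1981), p. 523: "since `Z` operates by
scalars on `ℋ_G^∞` the operators `π^∞(X)` for `X ∈ 𝔘(Z)` are also scalar".
[cite: JacquetShalikaAJM1981, §3, Prop. (3.8), p. 523] [cite: KnappVogan1995, Introduction, Thm. 0.2 and Notes] -/
theorem exists_archDerivE_scalar_eq_smul (hτ : τ.IsStronglyContinuous) (hτu : τ.IsUnitary)
    (hτi : τ.IsTopIrreducible) (x : mixedSpace K) :
    ∃ d : ℂ, ∀ v ∈ archGardingSpace hcpt τ,
      archDerivE hcpt τ (x • (1 : Matrix (Fin n) (Fin n) (mixedSpace K))) v = d • v := by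
  set X : Matrix (Fin n) (Fin n) (mixedSpace K) := x • (1 : Matrix (Fin n) (Fin n) (mixedSpace K)) with hX
  refine exists_eq_smul_of_invariant_of_partner hτ hτu hτi (archDerivE hcpt τ X) (fun u => -archDerivE hcpt τ X u)
    (fun v hv v' hv' => ?_) (fun c v hv => ?_) (fun g v hv => ?_) (fun v hv u hu => ?_)
  · have h := archWordDerivE_add hτ hv hv' [X]
    simpa only [archWordDerivE_cons, archWordDerivE_nil] using h
  · have h := archWordDerivE_smul hτ c hv [X]
    simpa only [archWordDerivE_cons, archWordDerivE_nil] using h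
  · rw [apply_toArch_archDerivE hτ hv g X]
    congr 1
    rw [hX, Matrix.mul_smul, Matrix.mul_one, Matrix.smul_mul, ← Units.val_mul, mul_inv_cancel, Units.val_one]
  · rw [inner_neg_right]
    exact inner_archDerivE_left hτ hτu hv hu X

end Segal

end Literature.NumberTheory.Automorphic
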